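import Mathlib.Analysis.Calculus.ImplicitContDiff
import Mathlib.Analysis.InnerProductSpace.PiL2
import Mathlib.Analysis.Calculus.Deriv.Comp
import Mathlib.Analysis.Calculus.Deriv.Add
import Mathlib.Analysis.Calculus.Deriv.Mul
import HarnessLib

/-!
# Smooth finite-parameter families in a level set with prescribed kernel tangents

The implicit-function-theorem step of the local deformation theory of underdetermined elliptic
equations (Chruściel–Delay, Mém. SMF 94 (2003), proof of Cor. 5.11; Corvino–Schoen 2006, §3):
if `Φ : E → F` is `C^∞` near `u₀` between Banach spaces and its linearisation `DΦ(u₀)` has a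
continuous right inverse `R` (so it is surjective with complemented kernel), then for every finite
family `v₁, …, v_k ∈ ker DΦ(u₀)` there is a `C^∞` family `u : B(0, r) ⊆ ℝᵏ → E` inside the level
set `{Φ = Φ(u₀)}` with `u(0) = u₀` and `∂_{c_j} u (0) = v_j`
(`exists_contDiffOn_family_of_rightInverse`). Proof: apply the implicit function theorem
(`ContDiffAt.implicitFunction`) to `f(c, w) = Φ(u₀ + Σ c_j v_j + R w)` on `ℝᵏ × F`, whose partial
derivative in `w` at `(0, 0)` is `DΦ(u₀) ∘ R = id` and in `c` is `DΦ(u₀)(Σ c_j v_j) = 0`; the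
implicit function `ψ` has `ψ(0) = 0`, `Dψ(0) = 0`, and is `C^∞` on a neighbourhood of `0`
(uniqueness of implicit functions, `eventually_apply_eq_iff_implicitFunction`, transfers the
pointwise smoothness `contDiffAt_implicitFunction` to nearby base points); `u(c) = u₀ + Σ c_j v_j
+ R ψ(c)`. Everything is proved; no named facts.

## References

* P. T. Chruściel, E. Delay, Mém. Soc. Math. Fr. 94 (2003), Cor. 5.11 and its proof.
  [ChruscielDelay2003]
* J. Corvino, R. Schoen, J. Differential Geom. 73 (2006), §3. [CorvinoSchoen2006]
-/

noncomputable section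

open Set Function Filter Metric
open scoped Topology ContDiff

namespace Literature.Analysis.Calculus

variable {E : Type*} [NormedAddCommGroup E] [NormedSpace ℝ E]
  {F : Type*} [NormedAddCommGroup F] [NormedSpace ℝ F] [CompleteSpace F]

/-- **Smoothness of an implicit function near the base point.** Let `f : P × F → F` be `C^∞` on
an open set `W`, and let `ψ : P → F` satisfy `(c₁, ψ c₁) ∈ W`, with
`∂_w f (c₁, ψ c₁)` invertible, and such that near `(c₁, ψ c₁)` the level set `{f = f (c₁, ψ c₁)}`
is the graph of `ψ`. Then `ψ` is `C^∞` at `c₁` (it agrees near `c₁` with the implicit function of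
`f` based at `(c₁, ψ c₁)`). [folklore] -/
theorem contDiffAt_of_levelSet_eq_graph {P : Type*} [NormedAddCommGroup P] [NormedSpace ℝ P]
    [CompleteSpace P] {f : P × F → F} {W : Set (P × F)} (hW : IsOpen W) (hf : ContDiffOn ℝ ∞ f W)
    {ψ : P → F} {c₁ : P} (hmem : (c₁, ψ c₁) ∈ W)
    (hinv : (fderiv ℝ f (c₁, ψ c₁) ∘L ContinuousLinearMap.inr ℝ P F).IsInvertible)
    (hgraph : ∀ᶠ q in 𝓝 (c₁, ψ c₁), f q = f (c₁, ψ c₁) ↔ ψ q.1 = q.2) :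
    ContDiffAt ℝ ∞ ψ c₁ := by
  have hfat : ContDiffAt ℝ ∞ f (c₁, ψ c₁) := (hf _ hmem).contDiffAt (hW.mem_nhds hmem)
  set ψ' := hfat.implicitFunction (by simp) hinv with hψ'
  have hψ'c : ψ' c₁ = ψ c₁ := hfat.implicitFunction_apply_self (by simp) hinv
  have hψ's : ContDiffAt ℝ ∞ ψ' c₁ := hfat.contDiffAt_implicitFunction (by simp) hinv
  have hψ'cont : ContinuousAt ψ' c₁ := hψ's.continuousAt
  have hev : ∀ᶠ c in 𝓝 c₁, f (c, ψ' c) = f (c₁, ψ c₁) :=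
    hfat.eventually_apply_implicitFunction (by simp) hinv
  -- near `c₁`, `(c, ψ' c)` lies in the uniqueness neighbourhood, hence `ψ c = ψ' c`
  have hpair : Tendsto (fun c ↦ (c, ψ' c)) (𝓝 c₁) (𝓝 (c₁, ψ c₁)) := by
    have h := (continuous_id.continuousAt (x := c₁)).prodMk hψ'cont
    rwa [ContinuousAt, id, hψ'c] at h
  have heq : ∀ᶠ c in 𝓝 c₁, ψ c = ψ' c := by
    filter_upwards [hpair.eventually hgraph, hev] with c hc1 hc2
    exact (hc1.1 hc2)
  exact hψ's.congr_of_eventuallyEq heq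

/-- **Smooth finite-parameter families in a level set with prescribed kernel tangents** (the
implicit-function step of Chruściel–Delay 2003, Cor. 5.11): see the module docstring.
[cite: ChruscielDelay2003, Cor. 5.11] -/
theorem exists_contDiffOn_family_of_rightInverse {Φ : E → F} {U : Set E} (hU : IsOpen U)
    (hΦ : ContDiffOn ℝ ∞ Φ U) {u₀ : E} (hu₀ : u₀ ∈ U) (R : F →L[ℝ] E)
    (hR : (fderiv ℝ Φ u₀).comp R = ContinuousLinearMap.id ℝ F) {k : ℕ} (v : Fin k → E)
    (hv : ∀ j, fderiv ℝ Φ u₀ (v j) = 0) :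
    ∃ (r : ℝ) (u : EuclideanSpace ℝ (Fin k) → E), 0 < r ∧ ContDiffOn ℝ ∞ u (ball 0 r) ∧ u 0 = u₀ ∧
      (∀ c ∈ ball (0 : EuclideanSpace ℝ (Fin k)) r, u c ∈ U ∧ Φ (u c) = Φ u₀) ∧
      ∀ j, deriv (fun s : ℝ ↦ u (EuclideanSpace.single j s)) 0 = v j := by
  set P := EuclideanSpace ℝ (Fin k)
  -- the linear map `c ↦ Σ c_j v_j`
  set lin : P →L[ℝ] E := ∑ j, (EuclideanSpace.proj j : P →L[ℝ] ℝ).smulRight (v j) with hlin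
  have hlin_apply : ∀ c : P, lin c = ∑ j, c j • v j := fun c ↦ by
    simp [hlin]
    rfl
  have hlin_single : ∀ j, lin (EuclideanSpace.single j (1 : ℝ)) = v j := fun j ↦ by
    rw [hlin_apply]
    simp [Finset.sum_ite_eq', ite_smul]
  have hΦlin : (fderiv ℝ Φ u₀).comp lin = 0 := by
    ext c
    rw [ContinuousLinearMap.comp_apply, hlin_apply, map_sum]
    simp [hv]
  -- the affine chart `A (c, w) = u₀ + lin c + R w` and the map `f = Φ ∘ A`
  set A : P × F → E := fun q ↦ u₀ + lin q.1 + R q.2 with hA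
  set L : P × F →L[ℝ] E := lin.comp (ContinuousLinearMap.fst ℝ P F) + R.comp (ContinuousLinearMap.snd ℝ P F)
    with hL
  have hAderiv : ∀ q, HasFDerivAt A L q := fun q ↦ by
    have h1 : HasFDerivAt (fun q : P × F ↦ lin q.1) (lin.comp (ContinuousLinearMap.fst ℝ P F)) q :=
      lin.hasFDerivAt.comp q hasFDerivAt_fst
    have h2 : HasFDerivAt (fun q : P × F ↦ R q.2) (R.comp (ContinuousLinearMap.snd ℝ P F)) q :=
      R.hasFDerivAt.comp q hasFDerivAt_snd
    have h := ((hasFDerivAt_const u₀ q).add h1).add h2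
    rw [zero_add] at h
    exact h
  have hAcont : Continuous A := by
    simp only [hA]; fun_prop
  have hA0 : A (0, 0) = u₀ := by simp [hA]
  set W : Set (P × F) := A ⁻¹' U with hW
  have hWo : IsOpen W := hU.preimage hAcont
  have h0W : ((0 : P), (0 : F)) ∈ W := by simp [hW, hA0, hu₀]
  set f : P × F → F := fun q ↦ Φ (A q) with hf
  have hAsmooth : ContDiff ℝ ∞ A := by
    simp only [hA]; fun_prop
  have hfW : ContDiffOn ℝ ∞ f W := hΦ.comp hAsmooth.contDiffOn fun q hq ↦ hq
  have hf0 : ContDiffAt ℝ ∞ f (0, 0) := (hfW _ h0W).contDiffAt (hWo.mem_nhds h0W)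
  -- the derivative of `f` at `(0, 0)`
  have hΦd : DifferentiableAt ℝ Φ u₀ := ((hΦ u₀ hu₀).contDiffAt (hU.mem_nhds hu₀)).differentiableAt (by simp)
  have hfderiv : fderiv ℝ f (0, 0) = (fderiv ℝ Φ u₀).comp L := by
    have h := hΦd.hasFDerivAt
    rw [← hA0] at h
    have h2 := (h.comp (0, 0) (hAderiv (0, 0))).fderiv
    rwa [hA0] at h2
  have hinr : fderiv ℝ f (0, 0) ∘L ContinuousLinearMap.inr ℝ P F = ContinuousLinearMap.id ℝ F := by
    rw [hfderiv, ContinuousLinearMap.comp_assoc]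
    have : L ∘L ContinuousLinearMap.inr ℝ P F = R := by
      ext w; simp [hL]
    rw [this, hR]
  have hinl : fderiv ℝ f (0, 0) ∘L ContinuousLinearMap.inl ℝ P F = 0 := by
    rw [hfderiv, ContinuousLinearMap.comp_assoc]
    have : L ∘L ContinuousLinearMap.inl ℝ P F = lin := by
      ext c; simp [hL]
    rw [this, hΦlin]
  have hinv : (fderiv ℝ f (0, 0) ∘L ContinuousLinearMap.inr ℝ P F).IsInvertible := by
    rw [hinr]
    exact ⟨ContinuousLinearEquiv.refl ℝ F, rfl⟩
  -- the implicit function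
  set ψ := hf0.implicitFunction (by simp) hinv with hψ
  have hψ0 : ψ 0 = 0 := hf0.implicitFunction_apply_self (by simp) hinv
  have hψev : ∀ᶠ c in 𝓝 (0 : P), f (c, ψ c) = f (0, 0) :=
    hf0.eventually_apply_implicitFunction (by simp) hinv
  have hψderiv : HasStrictFDerivAt ψ (0 : P →L[ℝ] F) 0 := by
    have h := hf0.hasStrictFDerivAt_implicitFunction (by simp) hinv
    rw [hinl, ContinuousLinearMap.comp_zero, neg_zero] at h
    exact h
  have hψat : ContDiffAt ℝ ∞ ψ 0 := hf0.contDiffAt_implicitFunction (by simp) hinv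
  have hgraph : ∀ᶠ q in 𝓝 ((0 : P), (0 : F)), f q = f (0, 0) ↔ ψ q.1 = q.2 :=
    hf0.eventually_apply_eq_iff_implicitFunction (by simp) hinv
  -- `ψ` is `C^∞` near `0`: the hypotheses of `contDiffAt_of_levelSet_eq_graph` are open conditions
  have hψcont : ContinuousAt ψ 0 := hψat.continuousAt
  have hpair : Tendsto (fun c ↦ (c, ψ c)) (𝓝 (0 : P)) (𝓝 (0, 0)) := by
    have h := (continuous_id.continuousAt (x := (0 : P))).prodMk hψcont
    rwa [ContinuousAt, id, hψ0] at h
  have hfd_cont : ContinuousAt (fun q ↦ fderiv ℝ f q) (0, 0) :=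
    ((hfW.fderiv_of_isOpen hWo (m := ∞) (by simp)).continuousOn.continuousAt (hWo.mem_nhds h0W))
  have hinv_open : ∀ᶠ q in 𝓝 ((0 : P), (0 : F)),
      (fderiv ℝ f q ∘L ContinuousLinearMap.inr ℝ P F).IsInvertible := by
    have hc : ContinuousAt (fun q ↦ fderiv ℝ f q ∘L ContinuousLinearMap.inr ℝ P F) (0, 0) :=
      ((ContinuousLinearMap.compL ℝ F (P × F) F).flip (ContinuousLinearMap.inr ℝ P F)).continuous.continuousAt.comp
        hfd_cont
    have hopen := ContinuousLinearEquiv.isOpen (𝕜 := ℝ) (E := F) (F := F)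
    have hmem : fderiv ℝ f (0, 0) ∘L ContinuousLinearMap.inr ℝ P F ∈
        range ((↑) : (F ≃L[ℝ] F) → F →L[ℝ] F) := by
      obtain ⟨e, he⟩ := hinv; exact ⟨e, he⟩
    filter_upwards [hc.preimage_mem_nhds (hopen.mem_nhds hmem)] with q hq
    obtain ⟨e, he⟩ := hq
    exact ⟨e, he⟩
  have hsmooth_ev : ∀ᶠ c₁ in 𝓝 (0 : P), ContDiffAt ℝ ∞ ψ c₁ := by
    -- continuity of `ψ` near `0`? only at points where we can run the argument: first get the
    -- graph property and membership near `0`, which give continuity via the implicit function there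
    have h1 : ∀ᶠ c₁ in 𝓝 (0 : P), (c₁, ψ c₁) ∈ W := hpair.eventually (hWo.mem_nhds h0W)
    have h2 : ∀ᶠ c₁ in 𝓝 (0 : P),
        (fderiv ℝ f (c₁, ψ c₁) ∘L ContinuousLinearMap.inr ℝ P F).IsInvertible := hpair.eventually hinv_open
    have h3 : ∀ᶠ c₁ in 𝓝 (0 : P), ∀ᶠ q in 𝓝 (c₁, ψ c₁), f q = f (0, 0) ↔ ψ q.1 = q.2 :=
      hpair.eventually hgraph.eventually_nhds
    have h4 : ∀ᶠ c₁ in 𝓝 (0 : P), f (c₁, ψ c₁) = f (0, 0) := hψev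
    -- continuity of `ψ` at nearby points: the level set near `(c₁, ψ c₁)` is a graph over `P` of
    -- the implicit function based there, which is continuous; so `ψ` is continuous there
    filter_upwards [h1, h2, h3, h4] with c₁ hc1 hc2 hc3 hc4
    have hgraph₁ : ∀ᶠ q in 𝓝 (c₁, ψ c₁), f q = f (c₁, ψ c₁) ↔ ψ q.1 = q.2 := by
      rw [hc4]; exact hc3
    -- continuity at `c₁` from the implicit function based at `(c₁, ψ c₁)`
    have hfat : ContDiffAt ℝ ∞ f (c₁, ψ c₁) := (hfW _ hc1).contDiffAt (hWo.mem_nhds hc1)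
    set ψ₁ := hfat.implicitFunction (by simp) hc2 with hψ₁
    have hψ₁c : ψ₁ c₁ = ψ c₁ := hfat.implicitFunction_apply_self (by simp) hc2
    have hψ₁cont : ContinuousAt ψ₁ c₁ := (hfat.contDiffAt_implicitFunction (by simp) hc2).continuousAt
    have hev₁ : ∀ᶠ c in 𝓝 c₁, f (c, ψ₁ c) = f (c₁, ψ c₁) :=
      hfat.eventually_apply_implicitFunction (by simp) hc2
    have hpair₁ : Tendsto (fun c ↦ (c, ψ₁ c)) (𝓝 c₁) (𝓝 (c₁, ψ c₁)) := by
      have h := (continuous_id.continuousAt (x := c₁)).prodMk hψ₁cont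
      rwa [ContinuousAt, id, hψ₁c] at h
    have heq : ∀ᶠ c in 𝓝 c₁, ψ c = ψ₁ c := by
      filter_upwards [hpair₁.eventually hgraph₁, hev₁] with c hc hc'
      exact hc.1 hc'
    have hψc : ContinuousAt ψ c₁ := hψ₁cont.congr_of_eventuallyEq heq
    exact contDiffAt_of_levelSet_eq_graph hWo hfW hc1 hc2 hgraph₁
  obtain ⟨r₁, hr₁, hball₁⟩ := Metric.eventually_nhds_iff_ball.1 (hsmooth_ev.and (hψev.and
    (hpair.eventually (hWo.mem_nhds h0W))))
  -- the family
  set u : P → E := fun c ↦ A (c, ψ c) with hu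
  refine ⟨r₁, u, hr₁, ?_, ?_, ?_, ?_⟩
  · intro c hc
    have hcs := (hball₁ c hc).1
    have : ContDiffAt ℝ ∞ u c := hAsmooth.contDiffAt.comp c (contDiffAt_id.prodMk hcs)
    exact this.contDiffWithinAt
  · simp [hu, hψ0, hA0]
  · intro c hc
    obtain ⟨_, hc2, hc3⟩ := hball₁ c hc
    refine ⟨hc3, ?_⟩
    have : f (c, ψ c) = f (0, 0) := hc2
    simpa [hf, hA0] using this
  · intro j
    -- `u ∘ single j = A ∘ (single j ·, ψ (single j ·))`, derivative `L (e_j, Dψ(0) e_j) = v j`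
    have hψd : HasFDerivAt ψ (0 : P →L[ℝ] F) 0 := hψderiv.hasFDerivAt
    have hcurve : HasDerivAt (fun s : ℝ ↦ EuclideanSpace.single j s) (EuclideanSpace.single j (1 : ℝ)) 0 := by
      have h : (fun s : ℝ ↦ EuclideanSpace.single j s) = fun s ↦ s • EuclideanSpace.single j (1 : ℝ) := by
        funext s
        ext i
        simp [PiLp.single_apply]
      rw [h]
      simpa using (hasDerivAt_id (0 : ℝ)).smul_const (EuclideanSpace.single j (1 : ℝ))
    have hinner : HasDerivAt (fun s : ℝ ↦ ((EuclideanSpace.single j s : P), ψ (EuclideanSpace.single j s)))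
        (EuclideanSpace.single j (1 : ℝ), (0 : F)) 0 := by
      have hψs : HasDerivAt (fun s : ℝ ↦ ψ (EuclideanSpace.single j s)) ((0 : P →L[ℝ] F) (EuclideanSpace.single j 1)) 0 := by
        have h0 : (EuclideanSpace.single j (0 : ℝ) : P) = 0 := by ext i; simp [PiLp.single_apply]
        have hψd' : HasFDerivAt ψ (0 : P →L[ℝ] F) (EuclideanSpace.single j (0 : ℝ)) := by rw [h0]; exact hψd
        exact hψd'.comp_hasDerivAt 0 hcurve
      simp only [_root_.zero_apply] at hψs
      exact hcurve.prodMk hψs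
    have hcomp : HasDerivAt (fun s : ℝ ↦ u (EuclideanSpace.single j s)) (L (EuclideanSpace.single j (1 : ℝ), (0 : F))) 0 :=
      (hAderiv _).comp_hasDerivAt 0 hinner
    rw [hcomp.deriv]
    simp [hL, hlin_single]

end Literature.Analysis.Calculus

end
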